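import Summits.HodgeConjecture.HodgeConjecture.Theorems.F0P3ClassificationKitV5   -- ★ V5-A p820470 (p03 (g6)): `Places`, `EvpData`, `EqOff`, `eqOffSetoid`, `Germ`, `germ` (+ the kit's sockets `Unr`, `hat`, pins (vii)(viii))
import Summits.HodgeConjecture.HodgeConjecture.Theorems.F0P3UnrTensorInstance      -- ★ (F0P4-p08 (g6)): `UnrTensor`, `hatOf`, `hatOf_congr`, `factorises`, `rich`, `unit`, `single`, `hatOf_unit`, `hatOf_single`
import HarnessLib

/-!
# Crux `H413` — T5 ED. 4, the 𝔠₀ instances of the sockets `Unr S` ∕ `hat S` of the classification kit: `Unr₀ S := UnrTensor L H S` (unramified pure tensors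
# off `S`) and `hat₀ S : Germ L H S → Unr₀ S → ℂ` (`f^S ↦ f^{S∧}(t)` ON GERMS), with PINS (vii) FACTORISATION and (viii) RICHNESS in the kit's literal shape

F0∕P3 «U3-mult», cell `hodgecm-mathlib`, crux H413 (`stmt-HodgeConjecture-24833`); integrator T5 `Cruxes/H413/Lines/F0_T5InnerFormClassification.lean` v5 (commit
94e361441a4b) ∕ ★ V5-A `Theorems/F0P3ClassificationKitV5.lean` (p820470): kit fields `Unr : Finset (Places L) → Type`, `hat : ∀ S, Germ L H S → Unr S → ℂ` (:211–:214) and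
pins `IsPinned` (vii) (:269–:273) ∕ (viii) (:275–:278).  RULING (V33)(5) (F0P3-plan (g5)), p04 (g7) census `F0/P3/F0P3-p04/CENSUS-C-pkg.F0P3p04g7.md` items 1–2.
★ `F0P3UnrTensorInstance` (F0P4-p08 (g6)) already carries the mathematics at the level of REPRESENTATIVES `t : EvpData L H` (`hatOf t F = ∏_{v ∈ F.T} t_v(f_v)`,
`hatOf_congr`: it only reads `t` off `S`); THIS FILE descends it to the kit's GERMS `Germ L H S = EvpData ⧸ EqOff S` and states the two pins with `𝔠.Unr ↦ Unr₀`,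
`𝔠.hat ↦ hat₀` and NOTHING ELSE changed, so that the ED. 4 closer discharges `IsPinned` (vii)(viii) at `𝔠₀` by `exact hat₀_factorises L H` ∕ `exact hat₀_rich L H`.
* `Unr₀ L H S` (abbrev) = ★ `UnrTensor L H S` [Rogawski1990 §13.7 p. 206 «`f ∈ ⊗_{v∉S} 𝓗_v`»; CartierCorvallis1979 §IV.1; Flath1979 §2].
* `hat₀ L H S g F := Quotient.liftOn g (hatOf · F) …` and `hat₀_germ : hat₀ S (germ S t) F = hatOf t F` (`rfl`).
* `hat₀_factorises` = pin (vii), `hat₀_rich` = pin (viii) — texts of ★ V5-A :269–:278 with the two substitutions; proofs = ★ `UnrTensor.factorises` ∕ `UnrTensor.rich`.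
* read-backs `hat₀_unit` (`f^{S∧}(t) = 1` at the unit tensor, every germ) and `hat₀_single` (`= t_v(f)` at a one-place probe).
Two small definitions WITH BODIES (`Unr₀` abbrev, `hat₀`), five theorems; no `sorry`, no named fact, no instance, no notation; imports no `Lines/`.
`--supports stmt-HodgeConjecture-24833 --as helper`.  HONEST LABEL: HC_CM is proved only modulo the printed citations until rung 0 closes.

References: [Rogawski1990] §13.7 p. 206; [CartierCorvallis1979] §IV.1 (Thm. 4.1, Cor. 4.1); [Flath1979] §2, Thm. 3.
-/

set_option autoImplicit false
-- the mandated namespace repeats `HodgeConjecture.HodgeConjecture`, as in every `Theorems/*.lean` of this sub-problem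
set_option linter.dupNamespace false

noncomputable section

open NumberField IsDedekindDomain MeasureTheory
open Literature.NumberTheory.Automorphic Literature.NumberTheory.Automorphic.UnitaryGroup

namespace Summit.HodgeConjecture.HodgeConjecture.Cruxes.H413.F0P3TestFunctionsOfRecord

open Summit.HodgeConjecture.HodgeConjecture.Cruxes.H413.F0P3InnerFormClassificationV5 (Places EvpData EqOff eqOffSetoid Germ germ)
open Summit.HodgeConjecture.HodgeConjecture.Cruxes.H413.F0P3UnrTensorInstance (UnrTensor)

variable (L : Type) [Field L] [NumberField L] [IsCMField L] (H : Matrix (Fin 3) (Fin 3) L)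

/-! ## §1 The carriers -/

/-- **`Unr₀ S`** — the 𝔠₀ instance of the kit's socket `Unr S`: unramified pure tensors off `S`, ★ `UnrTensor L H S` (local factors
`f_v ∈ C_c(K_v\G′_v/K_v)`, `= 𝟙_{K_v}` off a declared finite `T` with `T ∩ S = ∅`). [cite: Rogawski1990, §13.7 p. 206] [cite: CartierCorvallis1979, §IV.1] -/
abbrev Unr₀ (S : Finset (Places L)) : Type := UnrTensor L H S

/-- **`hat₀ S g F = f^{S∧}(t)`** — the 𝔠₀ instance of the kit's socket `hat S : Germ L H S → Unr S → ℂ`: ★ `UnrTensor.hatOf` (`∏_{v ∈ F.T} t_v(f_v)`) descended to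
the GERM `g` of `t` off `S` (well defined by ★ `UnrTensor.hatOf_congr`: `hatOf` reads `t` only off `S`). [cite: Rogawski1990, §13.7 p. 206] [cite: CartierCorvallis1979, §IV.1 Cor. 4.1] -/
def hat₀ (S : Finset (Places L)) (g : Germ L H S) (F : Unr₀ L H S) : ℂ :=
  Quotient.liftOn g (fun t : EvpData L H => UnrTensor.hatOf t F) fun _ _ h => UnrTensor.hatOf_congr h F

/-- Computation rule ON REPRESENTATIVES: `hat₀ S (germ S t) F = hatOf t F = ∏_{v ∈ F.T} t_v(f_v)` (`rfl`). [cite: Rogawski1990, §13.7 p. 206] -/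
theorem hat₀_germ (S : Finset (Places L)) (t : EvpData L H) (F : Unr₀ L H S) : hat₀ L H S (germ L H S t) F = UnrTensor.hatOf t F := rfl

/-! ## §2 Pins (vii) and (viii) of `IsPinned` AT `(Unr₀, hat₀)` — the texts of ★ V5-A :269–:278 with `𝔠.Unr ↦ Unr₀`, `𝔠.hat ↦ hat₀` -/

/-- **PIN (vii) at 𝔠₀ — `hat₀` FACTORISES**: `f^{S∧}(t) = ∏_{v ∈ T} t_v(f_v)` over a finite set `T` of places off `S` with `f_v ∈ C_c(K_v\G′_v/K_v)`, for every
representative `t` of the germ (★ `UnrTensor.factorises`: the declared support and the local factors). [cite: Rogawski1990, §13.7 p. 206] [cite: CartierCorvallis1979, §IV.1] -/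
theorem hat₀_factorises :
    ∀ (S : Finset (Places L)) (fT : Unr₀ L H S), ∃ T : Finset (Places L), Disjoint T S ∧
      ∃ f : ∀ v : Places L, (cmDatum L 3 H).Local v → ℂ,
        (∀ v ∈ T, HasCompactSupport (f v) ∧ IsLevel (cmLocalIntegralLevel L 3 H v) (f v)) ∧
        ∀ t : EvpData L H, hat₀ L H S (germ L H S t) fT = ∏ v ∈ T, t v (f v) :=
  fun _ fT => UnrTensor.factorises fT

/-- **PIN (viii) at 𝔠₀ — `Unr₀ S` IS RICH**: every finite family of spherical Hecke functions off `S` is the factor family of some `f^S` (★ `UnrTensor.rich`: the family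
padded by `𝟙_{K_v}`). [cite: CartierCorvallis1979, §IV.1] [cite: Rogawski1990, §13.7 p. 206] -/
theorem hat₀_rich :
    ∀ (S T : Finset (Places L)), Disjoint T S → ∀ f : ∀ v : Places L, (cmDatum L 3 H).Local v → ℂ,
      (∀ v ∈ T, HasCompactSupport (f v) ∧ IsLevel (cmLocalIntegralLevel L 3 H v) (f v)) →
      ∃ fT : Unr₀ L H S, ∀ t : EvpData L H, hat₀ L H S (germ L H S t) fT = ∏ v ∈ T, t v (f v) :=
  fun _ T hT f hf => UnrTensor.rich T hT f hf

/-! ## §3 Read-backs on germs -/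

/-- `f^{S∧} ≡ 1` at the unit tensor `𝟙 = ⊗_v 𝟙_{K_v}`, for EVERY germ (empty product). [cite: CartierCorvallis1979, §IV.1] -/
@[simp] theorem hat₀_unit (S : Finset (Places L)) (g : Germ L H S) : hat₀ L H S g UnrTensor.unit = 1 := by
  induction g using Quotient.inductionOn with
  | h t => exact UnrTensor.hatOf_unit t

/-- `f^{S∧}(t) = t_v(f)` at the one-place probe `𝟙 ⊗ ⋯ ⊗ f_v ⊗ ⋯ ⊗ 𝟙` (`v ∉ S`) — the probes of (L1-i). [cite: Rogawski1990, §13.7 p. 206] -/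
@[simp] theorem hat₀_single (S : Finset (Places L)) (t : EvpData L H) (v : Places L) (hv : v ∉ S) (f : (cmDatum L 3 H).Local v → ℂ)
    (hf : HasCompactSupport f) (hKf : IsLevel (cmLocalIntegralLevel L 3 H v) f) :
    hat₀ L H S (germ L H S t) (UnrTensor.single v hv f hf hKf) = t v f :=
  UnrTensor.hatOf_single t v hv f hf hKf

end Summit.HodgeConjecture.HodgeConjecture.Cruxes.H413.F0P3TestFunctionsOfRecord

end
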